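import Literature.NumberTheory.Transcendental.AyoubPeriodSeriesLocalizing
import Literature.NumberTheory.Transcendental.AyoubPeriodSeriesVariables
import HarnessLib

/-!
# Théorème 1.11 as `(2πi)^ℕ`-torsion: the Lean rendering is independent of the realising `g`

Proofs only (no definition, no named fact), on top of
`Literature/NumberTheory/Transcendental/AyoubPeriodSeries.lean` (the named fact
`ayoub_integration_injective_localized` = J. Ayoub, *La version relative de la conjecture des
périodes de Kontsevich–Zagier revisitée*, `AyoubRelKZRevisited`, Théorème 1.11: term-by-term
integration `𝒫†(k, σ) = 𝒫†,eff(k, σ)[(2πi)⁻¹] → ℂ((ϖ))` is injective), and the proof files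
`AyoubPeriodSeriesLocalizing.lean` (`(2πi)^N = ∫ g` for some `g ∈ 𝒪_{k-alg}(𝔻̄^∞)` avoiding any
finite set of variables) and `AyoubPeriodSeriesVariables.lean` (every `F ∈ 𝒪†_{k-alg}(𝔻̄^∞)`
involves finitely many variables).

## What is proved

* `exists_disjoint_intC_eq_two_pi_I_pow`: for every `F ∈ 𝒪†_{k-alg}(𝔻̄^∞)` (`char k = 0`) and
  every `N` there is `g ∈ 𝒪_{k-alg}(𝔻̄^∞)` in variables disjoint from those of `F` with
  `∫ g = (2πi)^N` — so `[g • F] = (2πi)^N · [F]` in the `𝒫^{eff}(k, σ)`-module `𝒫†,eff(k, σ)`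
  (Notation 1.9 (ii): the product of classes in disjoint variables) is always realisable.
* `smul_mem_kSpan_anGenerators_of_intC_eq`: the condition "`g • F ∈ ⟨(a), (b)⟩_k`" does not
  depend on the choice of `g` (two realisations differ by the type (b) generator `(g - g') • F`,
  `∫ (g - g') = 0`) — well-definedness of the `𝒫^{eff}`-action, Notation 1.9 (ii).
* `ayoub_integration_injective_localized_iff_forall`: hence the named fact (stated with `∃ g`)
  is EQUIVALENT to its `∀ g` form: `∫ F = 0 ⟹ ∃ N, ∀ g ∈ 𝒪_{k-alg}(𝔻̄^∞)` disjoint from `F` with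
  `∫ g = (2πi)^N`, `g • F ∈ ⟨(a), (b)⟩_k`, i.e. "`∫ F = 0 ⟹ (2πi)^N · [F] = 0` in `𝒫†,eff(k, σ)`
  for some `N`" = injectivity of `𝒫†,eff(k, σ)[(2πi)⁻¹] → ℂ((ϖ))`, Théorème 1.11 as printed.
  (The theorem itself is Ayoub's motivic result and stays a named fact.)
-/

noncomputable section

open Finsupp MvPowerSeries

namespace Literature.NumberTheory.Transcendental.AyoubRel

/-- A variable involved in `F - G` is involved in `F` or in `G`. [folklore] -/
theorem usesVar_sub {F G : CSeries} {i : ℕ} (h : UsesVar (F - G) i) : UsesVar F i ∨ UsesVar G i := by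
  obtain ⟨a, hai, hne⟩ := h
  by_cases hF : coeff a F = 0
  · refine Or.inr ⟨a, hai, fun hG => hne ?_⟩
    rw [map_sub, hF, hG, sub_zero]
  · exact Or.inl ⟨a, hai, hF⟩

section Torsion

variable {k : Type} [Field k] (σ : k →+* ℂ)

/-- **The localisation at `2πi` is realisable inside the Lean rendering of Théorème 1.11**: for
every `F ∈ 𝒪†_{k-alg}(𝔻̄^∞)` (`char k = 0`) and every `N` there is `g ∈ 𝒪_{k-alg}(𝔻̄^∞)` in
variables disjoint from those of `F` with `∫ g = (2πi)^N` (witness: `perGermPow M N` beyond the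
variables of `F`). [cite: AyoubRelKZRevisited, Notation 1.9 (iii)] -/
theorem exists_disjoint_intC_eq_two_pi_I_pow [CharZero k] {F : LaurentSeries CSeries}
    (hF : F ∈ OanDagger σ) (N : ℕ) :
    ∃ g ∈ Oan σ, (∀ i, ¬ (UsesVar g i ∧ UsesVarL F i)) ∧
      intC g = (2 * Real.pi * Complex.I) ^ N := by
  obtain ⟨M, hM⟩ := exists_bound_usesVarL_of_mem_OanDagger σ hF
  refine ⟨perGermPow M N, perGermPow_mem_Oan σ M N, fun i ⟨hg, hFi⟩ => ?_, intC_perGermPow M N⟩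
  have h1 := (usesVar_perGermPow hg).1
  have h2 := hM i hFi
  omega

/-- **Well-definedness of the `𝒫^{eff}(k, σ)`-action on `𝒫†,eff(k, σ)`** (Notation 1.9 (ii)): if
`g, g' ∈ 𝒪_{k-alg}(𝔻̄^∞)` are both in variables disjoint from those of `F ∈ 𝒪†_{k-alg}(𝔻̄^∞)` and
`∫ g = ∫ g'`, then `g • F ≡ g' • F` modulo the type (b) generator `(g - g') • F`; in particular
`g • F ∈ ⟨(a), (b)⟩_k ⟹ g' • F ∈ ⟨(a), (b)⟩_k`. [cite: AyoubRelKZRevisited, Notation 1.9 (ii)] -/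
theorem smul_mem_kSpan_anGenerators_of_intC_eq {F : LaurentSeries CSeries} (hF : F ∈ OanDagger σ)
    {g g' : CSeries} (hg : g ∈ Oan σ) (hg' : g' ∈ Oan σ)
    (hdg : ∀ i, ¬ (UsesVar g i ∧ UsesVarL F i)) (hdg' : ∀ i, ¬ (UsesVar g' i ∧ UsesVarL F i))
    (hint : intC g = intC g') (hspan : g • F ∈ kSpan σ (anGenerators σ)) :
    g' • F ∈ kSpan σ (anGenerators σ) := by
  have hsub : (g - g') • F ∈ kSpan σ (anGenerators σ) := by
    refine subset_kSpan σ _ (Or.inr ⟨g - g', sub_mem_Oan σ hg hg', ?_, F, hF, ?_, rfl⟩)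
    · rw [intC_sub (summable_norm_coeff_of_mem_Oan σ hg) (summable_norm_coeff_of_mem_Oan σ hg'),
        hint, sub_self]
    · rintro i ⟨hi, hFi⟩
      rcases usesVar_sub hi with h | h
      · exact hdg i ⟨h, hFi⟩
      · exact hdg' i ⟨h, hFi⟩
  have hrepr : g' • F = g • F - (g - g') • F := by
    apply HahnSeries.ext
    funext r
    rw [HahnSeries.coeff_sub, HahnSeries.coeff_smul, HahnSeries.coeff_smul, HahnSeries.coeff_smul,
      smul_eq_mul, smul_eq_mul, smul_eq_mul, sub_mul, sub_sub_cancel]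
  rw [hrepr]
  exact kSpan_sub σ hspan hsub

end Torsion

/-- **Théorème 1.11, `∃`-form ⟺ `∀`-form.** The named fact `ayoub_integration_injective_localized`
("`∫ F = 0 ⟹ ∃ N, ∃ g` disjoint from `F`, `∫ g = (2πi)^N`, `g • F ∈ ⟨(a), (b)⟩_k`") is
equivalent to: `∫ F = 0 ⟹ ∃ N, ∀ g ∈ 𝒪_{k-alg}(𝔻̄^∞)` disjoint from `F` with `∫ g = (2πi)^N`,
`g • F ∈ ⟨(a), (b)⟩_k` — i.e. "`(2πi)^N · [F] = 0` in `𝒫†,eff(k, σ)` for some `N`", the vanishing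
of `[F]` in `𝒫†(k, σ) = 𝒫†,eff(k, σ)[(2πi)⁻¹]`: injectivity of `∫ : 𝒫†(k, σ) → ℂ((ϖ))` exactly as
printed (`⇒`: independence of `g`; `⇐`: a realising `g` exists, `exists_disjoint_intC_eq_two_pi_I_pow`).
[cite: AyoubRelKZRevisited, Théorème 1.11 and Notation 1.9 (ii)–(iii)] -/
theorem ayoub_integration_injective_localized_iff_forall :
    ayoub_integration_injective_localized ↔
      ∀ (k : Type) [Field k] [CharZero k] (σ : k →+* ℂ),
        ∀ F ∈ OanDagger σ, intCLaurent F = 0 →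
          ∃ N : ℕ, ∀ g ∈ Oan σ, (∀ i, ¬ (UsesVar g i ∧ UsesVarL F i)) →
            intC g = (2 * Real.pi * Complex.I) ^ N → g • F ∈ kSpan σ (anGenerators σ) := by
  constructor
  · intro h k _ _ σ F hF h0
    obtain ⟨N, g, hg, hdg, hint, hspan⟩ := h k σ F hF h0
    exact ⟨N, fun g' hg' hdg' hint' =>
      smul_mem_kSpan_anGenerators_of_intC_eq σ hF hg hg' hdg hdg' (hint.trans hint'.symm) hspan⟩
  · intro h k _ _ σ F hF h0
    obtain ⟨N, hN⟩ := h k σ F hF h0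
    obtain ⟨g, hg, hdg, hint⟩ := exists_disjoint_intC_eq_two_pi_I_pow σ hF N
    exact ⟨N, g, hg, hdg, hint, hN g hg hdg hint⟩

end Literature.NumberTheory.Transcendental.AyoubRel
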